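import Summits.QuantumAdvantage.QuantumAdvantage.Theorems.CharDialTokenDialQ1
import Summits.QuantumAdvantage.QuantumAdvantage.Theorems.CharDialTokenDialP
import HarnessLib

/-!
# WalkHardFJLinOdd — the token dial, part Q: the MID-RANGE flip dial absorbed — readers anywhere within `(log₂ n)³` of the pair, by name

Cell `decomp-qadv`, lens 6, generation 19 (REV4 «FarFlipDial», mid-range supplement).  (1) the pieces `ResidualHighMidSide B`,
`LowResidualMidSide B`, `ResidualMidSide` = the far pieces of part P with the ninth escape clause WIDENED from window `dialB n` to window
`farL n = (log₂ n)³`: `¬ FlipHyp p (dialB n) (farL n) y` (and the tenth clause `¬ FarFlipHyp p (dialB n) (dialB n) (farL n) y` kept);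
(2) the widening costs nothing: each far piece is EQUIVALENT to its mid-range residual (`flip_hard_mid`, part Q1, absorbed with
`θ := max θ_mid (1 − 1/(48p))`; the converse by monotonicity of `FlipHyp` in the window once `dialB n ≤ farL n`, i.e. `n ≥ 8`), hence BY NAME
`JLinLowResidual5 ⟺ LowResidualMidSide dialB` (item 27206), `JLinResidualHigh5 ⟺ ResidualHighMidSide dialB` (item 27207), `T ⟺ ResidualMidSide`;
(3) `fieldY` escapes the mid-range dial too (`field_not_flip` is window-free), so class(RESIDUAL-HIGH-MID) is inhabited and the HIGH residual is
tested non-vacuously.  After parts M/P/Q the LOW residual of `T` is: LOW JLin strategies such that at EVERY adjacent pair either more than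
`4(log₂ n+1)` cuts move, or some moving cut is neither within `(log₂ n)³` of the pair nor a far reader with independent gap rows, or
`#flipAny < 2ⁿ/(4p)`.
-/

set_option autoImplicit false

open Finset

namespace Summit.QuantumAdvantage.AdviceFreeQNC0.JLinPeel

namespace TowerDefs

variable {n : ℕ}

/-- **piece RESIDUAL-HIGH-MID.** `ResidualHighFarSide` with the ninth clause widened to window `farL n`: `¬ FlipHyp p (dialB n) (farL n) y`. -/
def ResidualHighMidSide (B : ℕ → ℕ) : Prop :=
  ∀ (p : ℕ) [Fact p.Prime], 5 ≤ p → ∃ θ : ℝ, θ < 1 ∧ ∃ n₀ : ℕ, ∀ n ≥ n₀, ∀ c : ℕ,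
    ∀ y : Fin (n + 1) → (Fin n → Bool) → Bool, JLinHyp p n y → ¬ LowVar B n y → ¬ FlipHyp p (dialB n) (farL n) y →
      ¬ FarFlipHyp p (dialB n) (dialB n) (farL n) y →
      (∀ D : JLinPeel.JLinData p n, D.strat = y → (∀ g, (D.J g).card ≤ Nat.log 2 n) →
          ¬ SpanHyp D ∧ ¬ SparseHyp D ∧ ¬ BlockHyp D ∧ ¬ NullHyp D ∧ ¬ MaskHyp D) →
        ((Finset.univ.filter fun u : Fin n → Bool => ringWinU c y u = true).card : ℝ) ≤ θ * (2 : ℝ) ^ n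

/-- **piece LOW-RESIDUAL-MID.** `LowResidualFarSide` with the ninth clause widened to window `farL n`. -/
def LowResidualMidSide (B : ℕ → ℕ) : Prop :=
  ∀ (p : ℕ) [Fact p.Prime], 5 ≤ p → ∃ θ : ℝ, θ < 1 ∧ ∃ n₀ : ℕ, ∀ n ≥ n₀, ∀ c : ℕ,
    ∀ y : Fin (n + 1) → (Fin n → Bool) → Bool, JLinHyp p n y → LowVar B n y → ¬ FlipHyp p (dialB n) (farL n) y →
      ¬ FarFlipHyp p (dialB n) (dialB n) (farL n) y →
      (∀ D : JLinPeel.JLinData p n, D.strat = y → (∀ g, (D.J g).card ≤ Nat.log 2 n) →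
          ¬ SpanHyp D ∧ ¬ SparseHyp D ∧ ¬ BlockHyp D ∧ ¬ NullHyp D ∧ ¬ MaskHyp D) →
        ((Finset.univ.filter fun u : Fin n → Bool => ringWinU c y u = true).card : ℝ) ≤ θ * (2 : ℝ) ^ n

/-- **the MID-RANGE RESIDUAL of T** (no variation condition). -/
def ResidualMidSide : Prop :=
  ∀ (p : ℕ) [Fact p.Prime], 5 ≤ p → ∃ θ : ℝ, θ < 1 ∧ ∃ n₀ : ℕ, ∀ n ≥ n₀, ∀ c : ℕ,
    ∀ y : Fin (n + 1) → (Fin n → Bool) → Bool, JLinHyp p n y → ¬ FlipHyp p (dialB n) (farL n) y →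
      ¬ FarFlipHyp p (dialB n) (dialB n) (farL n) y →
      (∀ D : JLinPeel.JLinData p n, D.strat = y → (∀ g, (D.J g).card ≤ Nat.log 2 n) →
          ¬ SpanHyp D ∧ ¬ SparseHyp D ∧ ¬ BlockHyp D ∧ ¬ NullHyp D ∧ ¬ MaskHyp D) →
        ((Finset.univ.filter fun u : Fin n → Bool => ringWinU c y u = true).card : ℝ) ≤ θ * (2 : ℝ) ^ n

end TowerDefs

namespace TokenDial

open SegMove

variable {n : ℕ}

section MidPieces

variable {p : ℕ} [hp : Fact p.Prime]

/-! ### (1) class-MID ⊆ class-FAR for `n ≥ 8`: the far pieces give the mid-range pieces -/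

omit hp in
/-- `dialB n ≤ farL n` once `n ≥ 8`. -/
theorem dialB_le_farL {n : ℕ} (hn : 8 ≤ n) : TowerDefs.dialB n ≤ TowerDefs.farL n := by
  have hℓ : 3 ≤ Nat.log 2 n := Nat.le_log_of_pow_le (by norm_num) (by omega)
  unfold TowerDefs.dialB TowerDefs.farL
  have h9 : 9 ≤ Nat.log 2 n ^ 2 := by nlinarith
  calc 4 * (Nat.log 2 n + 1) ≤ 9 * Nat.log 2 n := by omega
    _ ≤ Nat.log 2 n ^ 2 * Nat.log 2 n := Nat.mul_le_mul_right _ h9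
    _ = Nat.log 2 n ^ 3 := by ring

omit hp in
/-- the common step: a far-shape piece gives the mid-shape piece (monotonicity of the ninth clause in the window, `n ≥ 8`). -/
theorem mid_of_far (V : (p n : ℕ) → (Fin (n + 1) → (Fin n → Bool) → Bool) → Prop)
    (h10 : ∀ (p : ℕ) [Fact p.Prime], 5 ≤ p → ∃ θ : ℝ, θ < 1 ∧ ∃ n₀ : ℕ, ∀ n ≥ n₀, ∀ c : ℕ,
      ∀ y : Fin (n + 1) → (Fin n → Bool) → Bool, TowerDefs.JLinHyp p n y → V p n y →
        ¬ TowerDefs.FlipHyp p (TowerDefs.dialB n) (TowerDefs.dialB n) y →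
        ¬ TowerDefs.FarFlipHyp p (TowerDefs.dialB n) (TowerDefs.dialB n) (TowerDefs.farL n) y →
        (∀ D : JLinPeel.JLinData p n, D.strat = y → (∀ g, (D.J g).card ≤ Nat.log 2 n) →
            ¬ TowerDefs.SpanHyp D ∧ ¬ TowerDefs.SparseHyp D ∧ ¬ TowerDefs.BlockHyp D ∧ ¬ TowerDefs.NullHyp D ∧
              ¬ TowerDefs.MaskHyp D) →
          ((Finset.univ.filter fun u : Fin n → Bool => ringWinU c y u = true).card : ℝ) ≤ θ * (2 : ℝ) ^ n) :
    ∀ (p : ℕ) [Fact p.Prime], 5 ≤ p → ∃ θ : ℝ, θ < 1 ∧ ∃ n₀ : ℕ, ∀ n ≥ n₀, ∀ c : ℕ,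
      ∀ y : Fin (n + 1) → (Fin n → Bool) → Bool, TowerDefs.JLinHyp p n y → V p n y →
        ¬ TowerDefs.FlipHyp p (TowerDefs.dialB n) (TowerDefs.farL n) y →
        ¬ TowerDefs.FarFlipHyp p (TowerDefs.dialB n) (TowerDefs.dialB n) (TowerDefs.farL n) y →
        (∀ D : JLinPeel.JLinData p n, D.strat = y → (∀ g, (D.J g).card ≤ Nat.log 2 n) →
            ¬ TowerDefs.SpanHyp D ∧ ¬ TowerDefs.SparseHyp D ∧ ¬ TowerDefs.BlockHyp D ∧ ¬ TowerDefs.NullHyp D ∧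
              ¬ TowerDefs.MaskHyp D) →
          ((Finset.univ.filter fun u : Fin n → Bool => ringWinU c y u = true).card : ℝ) ≤ θ * (2 : ℝ) ^ n := by
  intro p _ hp5
  obtain ⟨θ, hθ, n₀, hn₀⟩ := h10 p hp5
  refine ⟨θ, hθ, max n₀ 8, fun n hn c y hy hV hF hFF hesc => hn₀ n (le_trans (le_max_left _ _) hn) c y hy hV ?_ hFF hesc⟩
  exact fun h => hF (flipHyp_mono le_rfl (dialB_le_farL (le_trans (le_max_right _ _) hn)) y h)

omit hp in
/-- RESIDUAL-FAR gives RESIDUAL-MID. -/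
theorem residualMid_of_residualFar : TowerDefs.ResidualFarSide → TowerDefs.ResidualMidSide := by
  intro h10
  have h := mid_of_far (fun _ _ _ => True) (fun p _ hp5 => by
    obtain ⟨θ, hθ, n₀, hn₀⟩ := h10 p hp5
    exact ⟨θ, hθ, n₀, fun n hn c y hy _ hF hFF hesc => hn₀ n hn c y hy hF hFF hesc⟩)
  intro p _ hp5
  obtain ⟨θ, hθ, n₀, hn₀⟩ := h p hp5
  exact ⟨θ, hθ, n₀, fun n hn c y hy hF hFF hesc => hn₀ n hn c y hy trivial hF hFF hesc⟩

omit hp in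
/-- LOW-RESIDUAL-FAR gives LOW-RESIDUAL-MID. -/
theorem lowResidualMid_of_lowResidualFar (B : ℕ → ℕ) : TowerDefs.LowResidualFarSide B → TowerDefs.LowResidualMidSide B :=
  fun h10 => mid_of_far (fun _ n y => TowerDefs.LowVar B n y) h10

omit hp in
/-- RESIDUAL-HIGH-FAR gives RESIDUAL-HIGH-MID. -/
theorem residualHighMid_of_residualHighFar (B : ℕ → ℕ) :
    TowerDefs.ResidualHighFarSide B → TowerDefs.ResidualHighMidSide B :=
  fun h10 => mid_of_far (fun _ n y => ¬ TowerDefs.LowVar B n y) h10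

/-! ### (2) the widening costs nothing -/

omit hp in
/-- **absorbing the mid-range flip dial** (the common step): under a side condition `V`, the mid piece gives the far piece,
`θ := max θ_mid (1 − 1/(48p))`; a strategy meeting `FlipHyp p (dialB n) (farL n)` is PRESENTED (by choice from `JLinHyp`) and handed to
`flip_hard_mid`. -/
theorem absorb_mid (V : (p n : ℕ) → (Fin (n + 1) → (Fin n → Bool) → Bool) → Prop)
    (h11 : ∀ (p : ℕ) [Fact p.Prime], 5 ≤ p → ∃ θ : ℝ, θ < 1 ∧ ∃ n₀ : ℕ, ∀ n ≥ n₀, ∀ c : ℕ,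
      ∀ y : Fin (n + 1) → (Fin n → Bool) → Bool, TowerDefs.JLinHyp p n y → V p n y →
        ¬ TowerDefs.FlipHyp p (TowerDefs.dialB n) (TowerDefs.farL n) y →
        ¬ TowerDefs.FarFlipHyp p (TowerDefs.dialB n) (TowerDefs.dialB n) (TowerDefs.farL n) y →
        (∀ D : JLinPeel.JLinData p n, D.strat = y → (∀ g, (D.J g).card ≤ Nat.log 2 n) →
            ¬ TowerDefs.SpanHyp D ∧ ¬ TowerDefs.SparseHyp D ∧ ¬ TowerDefs.BlockHyp D ∧ ¬ TowerDefs.NullHyp D ∧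
              ¬ TowerDefs.MaskHyp D) →
          ((Finset.univ.filter fun u : Fin n → Bool => ringWinU c y u = true).card : ℝ) ≤ θ * (2 : ℝ) ^ n) :
    ∀ (p : ℕ) [Fact p.Prime], 5 ≤ p → ∃ θ : ℝ, θ < 1 ∧ ∃ n₀ : ℕ, ∀ n ≥ n₀, ∀ c : ℕ,
      ∀ y : Fin (n + 1) → (Fin n → Bool) → Bool, TowerDefs.JLinHyp p n y → V p n y →
        ¬ TowerDefs.FlipHyp p (TowerDefs.dialB n) (TowerDefs.dialB n) y →
        ¬ TowerDefs.FarFlipHyp p (TowerDefs.dialB n) (TowerDefs.dialB n) (TowerDefs.farL n) y →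
        (∀ D : JLinPeel.JLinData p n, D.strat = y → (∀ g, (D.J g).card ≤ Nat.log 2 n) →
            ¬ TowerDefs.SpanHyp D ∧ ¬ TowerDefs.SparseHyp D ∧ ¬ TowerDefs.BlockHyp D ∧ ¬ TowerDefs.NullHyp D ∧
              ¬ TowerDefs.MaskHyp D) →
          ((Finset.univ.filter fun u : Fin n → Bool => ringWinU c y u = true).card : ℝ) ≤ θ * (2 : ℝ) ^ n := by
  intro p _ hp5
  have hp3 : p ≠ 3 := by omega
  obtain ⟨θ, hθ, n₉, hn₉⟩ := h11 p hp5
  obtain ⟨n₁, hn₁⟩ := flip_hard_mid (p := p) hp3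
  have hpR : (0 : ℝ) < p := by exact_mod_cast (show 0 < p by omega)
  have hθ' : (1 : ℝ) - 1 / (48 * p) < 1 := by
    have : (0 : ℝ) < 1 / (48 * p) := by positivity
    linarith
  refine ⟨max θ (1 - 1 / (48 * p)), max_lt hθ hθ', max n₉ n₁, fun n hn c y hy hV hF hFF hesc => ?_⟩
  have h2n : (0 : ℝ) ≤ (2 : ℝ) ^ n := by positivity
  by_cases hfl : TowerDefs.FlipHyp p (TowerDefs.dialB n) (TowerDefs.farL n) y
  · have hy' := hy
    unfold TowerDefs.JLinHyp at hy'
    choose J hJ a h hdep hrep using hy'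
    let D : JLinPeel.JLinData p n := ⟨J, a, h, fun g u v huv s => hdep g u v huv s⟩
    have hD : D.strat = y := by
      funext g u
      exact (hrep g u).symm
    have hfl' : TowerDefs.FlipHyp p (TowerDefs.dialB n) (TowerDefs.farL n) D.strat := by rw [hD]; exact hfl
    have h := hn₁ n (le_trans (le_max_right _ _) hn) c D hJ hfl'
    rw [hD] at h
    exact h.trans (mul_le_mul_of_nonneg_right (le_max_right _ _) h2n)
  · have h := hn₉ n (le_trans (le_max_left _ _) hn) c y hy hV hfl hFF hesc
    exact h.trans (mul_le_mul_of_nonneg_right (le_max_left _ _) h2n)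

omit hp in
/-- ★ the mid-range residual gives the far residual (mid-range dial absorbed). -/
theorem residualFar_of_residualMid : TowerDefs.ResidualMidSide → TowerDefs.ResidualFarSide := by
  intro h11
  have h := absorb_mid (fun _ _ _ => True) (fun p _ hp5 => by
    obtain ⟨θ, hθ, n₀, hn₀⟩ := h11 p hp5
    exact ⟨θ, hθ, n₀, fun n hn c y hy _ hF hFF hesc => hn₀ n hn c y hy hF hFF hesc⟩)
  intro p _ hp5
  obtain ⟨θ, hθ, n₀, hn₀⟩ := h p hp5
  exact ⟨θ, hθ, n₀, fun n hn c y hy hF hFF hesc => hn₀ n hn c y hy trivial hF hFF hesc⟩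

omit hp in
/-- ★ LOW-RESIDUAL-MID gives LOW-RESIDUAL-FAR, every schedule `B`. -/
theorem lowResidualFar_of_lowResidualMid (B : ℕ → ℕ) : TowerDefs.LowResidualMidSide B → TowerDefs.LowResidualFarSide B :=
  fun h11 => absorb_mid (fun _ n y => TowerDefs.LowVar B n y) h11

omit hp in
/-- ★ RESIDUAL-HIGH-MID gives RESIDUAL-HIGH-FAR, every schedule `B`. -/
theorem residualHighFar_of_residualHighMid (B : ℕ → ℕ) :
    TowerDefs.ResidualHighMidSide B → TowerDefs.ResidualHighFarSide B :=
  fun h11 => absorb_mid (fun _ n y => ¬ TowerDefs.LowVar B n y) h11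

omit hp in
/-- ★★ RESIDUAL-FAR ⟺ RESIDUAL-MID. -/
theorem residualFar_iff_residualMid : TowerDefs.ResidualFarSide ↔ TowerDefs.ResidualMidSide :=
  ⟨residualMid_of_residualFar, residualFar_of_residualMid⟩

omit hp in
/-- ★★ LOW-RESIDUAL-FAR ⟺ LOW-RESIDUAL-MID, every schedule `B`. -/
theorem lowResidualFar_iff_lowResidualMid (B : ℕ → ℕ) :
    TowerDefs.LowResidualFarSide B ↔ TowerDefs.LowResidualMidSide B :=
  ⟨lowResidualMid_of_lowResidualFar B, lowResidualFar_of_lowResidualMid B⟩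

omit hp in
/-- ★★ RESIDUAL-HIGH-FAR ⟺ RESIDUAL-HIGH-MID, every schedule `B`. -/
theorem residualHighFar_iff_residualHighMid (B : ℕ → ℕ) :
    TowerDefs.ResidualHighFarSide B ↔ TowerDefs.ResidualHighMidSide B :=
  ⟨residualHighMid_of_residualHighFar B, residualHighFar_of_residualHighMid B⟩

omit hp in
/-- ★ RESIDUAL⁵ ⟺ RESIDUAL-MID. -/
theorem residual5_iff_residualMid : TowerDefs.Residual5Side ↔ TowerDefs.ResidualMidSide :=
  residual5_iff_residualFar.trans residualFar_iff_residualMid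

end MidPieces

/-! ### (3) the mid-range split of T, by name -/

/-- ★★ **the DECIDING THEOREM of the mid-range split** (item vocabulary): LOW-RESIDUAL-MID ∧ RESIDUAL-HIGH-MID at schedule `dialB`
close `T`. -/
theorem closes_splitMid (hL : TowerDefs.LowResidualMidSide TowerDefs.dialB)
    (hH : TowerDefs.ResidualHighMidSide TowerDefs.dialB) :
    Summit.QuantumAdvantage.QuantumAdvantage.Theses.CharDial.WalkHardFJLinOdd :=
  closes_splitFar (lowResidualFar_of_lowResidualMid TowerDefs.dialB hL) (residualHighFar_of_residualHighMid TowerDefs.dialB hH)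

/-- ★★ conversely `T` gives both mid-range pieces. -/
theorem splitMid_of_closes (hT : Summit.QuantumAdvantage.QuantumAdvantage.Theses.CharDial.WalkHardFJLinOdd) :
    TowerDefs.LowResidualMidSide TowerDefs.dialB ∧ TowerDefs.ResidualHighMidSide TowerDefs.dialB :=
  let ⟨hL, hH⟩ := splitFar_of_closes hT
  ⟨lowResidualMid_of_lowResidualFar _ hL, residualHighMid_of_residualHighFar _ hH⟩

/-- ★★ `T ⟺ LOW-RESIDUAL-MID(dialB) ∧ RESIDUAL-HIGH-MID(dialB)`. -/
theorem walkHardFJLinOdd_iff_residualMid_split :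
    Summit.QuantumAdvantage.QuantumAdvantage.Theses.CharDial.WalkHardFJLinOdd ↔
      (TowerDefs.LowResidualMidSide TowerDefs.dialB ∧ TowerDefs.ResidualHighMidSide TowerDefs.dialB) :=
  ⟨splitMid_of_closes, fun h => closes_splitMid h.1 h.2⟩

/-- ★★ `T ⟺ RESIDUAL-MID` (the flip dial at window `(log₂ n)³` and the far dial absorbed, no variation split). -/
theorem walkHardFJLinOdd_iff_residualMid :
    Summit.QuantumAdvantage.QuantumAdvantage.Theses.CharDial.WalkHardFJLinOdd ↔ TowerDefs.ResidualMidSide :=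
  walkHardFJLinOdd_iff_residualFar.trans residualFar_iff_residualMid

/-- ★ the filed LOW piece (item 27206) ⟺ LOW-RESIDUAL-MID(dialB), by name. -/
theorem jlinLowResidual5_iff_lowResidualMid :
    Summit.QuantumAdvantage.QuantumAdvantage.Theses.CharDial.JLinLowResidual5 ↔
      TowerDefs.LowResidualMidSide TowerDefs.dialB :=
  jlinLowResidual5_iff_lowResidualFar.trans (lowResidualFar_iff_lowResidualMid TowerDefs.dialB)

/-- ★ the filed HIGH residual (item 27207) ⟺ RESIDUAL-HIGH-MID(dialB), by name. -/
theorem jlinResidualHigh5_iff_residualHighMid :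
    Summit.QuantumAdvantage.QuantumAdvantage.Theses.CharDial.JLinResidualHigh5 ↔
      TowerDefs.ResidualHighMidSide TowerDefs.dialB :=
  jlinResidualHigh5_iff_residualHighFar.trans (residualHighFar_iff_residualHighMid TowerDefs.dialB)

/-! ### (4) the RESIDUAL-HIGH-MID class is inhabited: `fieldY` has more than `dialB n` moving cuts at every adjacency (any window) -/

section EscapeMid

variable {p : ℕ} [hp : Fact p.Prime]

/-- ★★★ **`fieldY` in class(RESIDUAL-HIGH-MID), eventually** (every prime `p ≥ 5`): JLin-presentable, HIGH at `dialB`, outside the flip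
dial at budget `dialB n` even with window `(log₂ n)³`, outside the far dial, and in EVERY `log₂ n`-junta presentation outside the rank,
sparse, block, null and mask dials. -/
theorem fieldY_classMid_eventually (hp5 : 5 ≤ p) : ∃ n₀ : ℕ, ∀ n ≥ n₀, ∃ α : GaloisField p (FieldCol.rk n),
    TowerDefs.JLinHyp p n (FieldCol.fieldY p n α) ∧ ¬ TowerDefs.LowVar TowerDefs.dialB n (FieldCol.fieldY p n α) ∧
    ¬ TowerDefs.FlipHyp p (TowerDefs.dialB n) (TowerDefs.farL n) (FieldCol.fieldY p n α) ∧
    ¬ TowerDefs.FarFlipHyp p (TowerDefs.dialB n) (TowerDefs.dialB n) (TowerDefs.farL n) (FieldCol.fieldY p n α) ∧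
    ∀ D : JLinPeel.JLinData p n, D.strat = FieldCol.fieldY p n α → (∀ g, (D.J g).card ≤ Nat.log 2 n) →
      ¬ TowerDefs.SpanHyp D ∧ ¬ TowerDefs.SparseHyp D ∧ ¬ TowerDefs.BlockHyp D ∧ ¬ TowerDefs.NullHyp D ∧
        ¬ TowerDefs.MaskHyp D := by
  have hp3 : p % 3 = 1 ∨ p % 3 = 2 := Tower.mod3_of_prime_ge5 hp.out hp5
  obtain ⟨n₁, hn₁⟩ := FieldCol.eventually_fits p
  obtain ⟨n₂, hn₂⟩ := FieldCol.eventually_big p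
  obtain ⟨n₃, hn₃⟩ := FieldCol.eventually_misc p
  obtain ⟨n₄, hn₄⟩ := FieldCol.field_not_span_eventually p
  refine ⟨max (max n₁ n₂) (max n₃ n₄), fun n hn => ?_⟩
  have hfit := hn₁ n (le_trans (le_trans (le_max_left _ _) (le_max_left _ _)) hn)
  have hbig := hn₂ n (le_trans (le_trans (le_max_right _ _) (le_max_left _ _)) hn)
  obtain ⟨hpL, hpn, hn9⟩ := hn₃ n (le_trans (le_trans (le_max_left _ _) (le_max_right _ _)) hn)
  have hspan := hn₄ n (le_trans (le_trans (le_max_right _ _) (le_max_right _ _)) hn)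
  obtain ⟨α, hα⟩ := FieldCol.exists_generic p n (by omega)
  have h0 : α ≠ 0 := FieldCol.generic_ne_zero p n (by omega) α hα
  have h1 : α ≠ 1 := FieldCol.generic_ne_one p n hpL hpn α hα
  have hL2 : 2 ≤ Nat.log 2 n := le_trans (by omega) hpL
  have hK : TowerDefs.dialB n + 1 ≤ 2 * (4 * (Nat.log 2 n + 1)) + 1 := by unfold TowerDefs.dialB; omega
  refine ⟨α, ?_, FieldCol.not_low_fieldY p n _ hbig le_rfl (by omega) α h0 h1,
    field_not_flip n (TowerDefs.dialB n) (TowerDefs.farL n) _ hbig hK α h0 h1,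
    field_not_farFlip n (TowerDefs.dialB n) (TowerDefs.dialB n) (TowerDefs.farL n) _ hbig hK α h0 h1, fun D hD hJ => ?_⟩
  · intro g
    exact ⟨∅, by simp, (FieldCol.fieldData p n α).a g, (FieldCol.fieldData p n α).h g, fun _ _ _ _ => rfl, fun u => rfl⟩
  · have hM : ¬ TowerDefs.MaskHyp D := (Tower.maskHyp_iff_inlined D).not.mpr (FieldCol.field_not_mask p n hfit α hα D hD hJ)
    exact ⟨(Tower.spanHyp_iff_inlined D).not.mpr (hspan α D hD hJ),
      (Tower.sparseHyp_iff_inlined D).not.mpr (FieldCol.field_not_sparse p n hfit hL2 α D hD),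
      fun hB => hM (Tower.maskHyp_of_blockHyp hp3 D hB), fun hN => hM (Tower.maskHyp_of_nullHyp D hN), hM⟩

/-- ★★★ **class(RESIDUAL-HIGH-MID) IS INHABITED** (item vocabulary). -/
theorem residualHighMid_class_inhabited (p : ℕ) [Fact p.Prime] (hp5 : 5 ≤ p) :
    ∃ n₁ : ℕ, ∀ n ≥ n₁, ∃ y : Fin (n + 1) → (Fin n → Bool) → Bool,
      TowerDefs.JLinHyp p n y ∧ ¬ TowerDefs.LowVar TowerDefs.dialB n y ∧
      ¬ TowerDefs.FlipHyp p (TowerDefs.dialB n) (TowerDefs.farL n) y ∧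
      ¬ TowerDefs.FarFlipHyp p (TowerDefs.dialB n) (TowerDefs.dialB n) (TowerDefs.farL n) y ∧
      ∀ D : JLinPeel.JLinData p n, D.strat = y → (∀ g, (D.J g).card ≤ Nat.log 2 n) →
        ¬ TowerDefs.SpanHyp D ∧ ¬ TowerDefs.SparseHyp D ∧ ¬ TowerDefs.BlockHyp D ∧ ¬ TowerDefs.NullHyp D ∧
          ¬ TowerDefs.MaskHyp D := by
  obtain ⟨n₀, h⟩ := fieldY_classMid_eventually (p := p) hp5
  exact ⟨n₀, fun n hn => let ⟨α, hy, hV, hF, hFF, hesc⟩ := h n hn; ⟨FieldCol.fieldY p n α, hy, hV, hF, hFF, hesc⟩⟩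

/-- ★ **RESIDUAL-HIGH-MID is tested NON-VACUOUSLY**: a purported `ResidualHighMidSide dialB` bound applies to an actual member of its
class. -/
theorem residualHighMid_nonvacuous (hR : TowerDefs.ResidualHighMidSide TowerDefs.dialB) (p : ℕ) [Fact p.Prime] (hp5 : 5 ≤ p) :
    ∃ θ : ℝ, θ < 1 ∧ ∃ n₀ : ℕ, ∀ n ≥ n₀, ∃ y : Fin (n + 1) → (Fin n → Bool) → Bool,
      TowerDefs.JLinHyp p n y ∧ ¬ TowerDefs.LowVar TowerDefs.dialB n y ∧ ∀ c : ℕ,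
        ((Finset.univ.filter fun u : Fin n → Bool => ringWinU c y u = true).card : ℝ) ≤ θ * (2 : ℝ) ^ n := by
  obtain ⟨θ, hθ, n₀, h⟩ := hR p hp5
  obtain ⟨n₁, h₁⟩ := residualHighMid_class_inhabited p hp5
  refine ⟨θ, hθ, max n₀ n₁, fun n hn => ?_⟩
  obtain ⟨y, hy, hV, hF, hFF, hesc⟩ := h₁ n (le_trans (le_max_right _ _) hn)
  exact ⟨y, hy, hV, fun c => h n (le_trans (le_max_left _ _) hn) c y hy hV hF hFF hesc⟩

end EscapeMid

end TokenDial

end Summit.QuantumAdvantage.AdviceFreeQNC0.JLinPeel
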